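import Literature.MathematicalPhysics.QuantumFieldTheory.Balaban1983to89.B6MainResultsOneLevel
import Literature.MathematicalPhysics.QuantumFieldTheory.Balaban1983to89.B5DictTorusEta
import Literature.MathematicalPhysics.QuantumFieldTheory.Balaban1983to89.B5Carrier132Maps

/-!
# `Balaban1983to89.B6Prop22BlockFamily` — [B6] **Proposition 2.2 (2.67), VERBATIM (`B6.Prop22Printed`), ON THE ONE-LEVEL BLOCK FAMILY
# of `B6MainResultsOneLevel`**: the GENUINE scalar propagator `G′ = Δ′_a⁻¹ = G′_K = (−Δ^η + m² + a_KQ′_K*Q′_K)⁻¹` of the torus tower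
# (`B1RG242Torus.tower`), seen through [4]'s (1.110)–(1.111) functionals OF RECORD (`B5GpSettingTorus.gpSetting`) and read on the
# lattice test functions and cut-offs of the block geometry through r02's carrier maps (`B5Carrier132Maps.pullV`/`σR`/`κR`) —
# the LAST of the eight conjuncts of the DAG leaf `b6` on these model carriers

FRAMING (verbatim cell line):
statement-level skeleton of published theorems with citation tags; proofs where landed; nothing here is a claim about the Yang–Mills mass gap

Sources (cell `lit-balaban`, HOME `run/shared/lean/pub/lit-balaban/`; seat **r03 gen 11** = the B6 fold owner, own lane under the
free-target protocol G.5-34(d); SKELETON rows **B6.Prop2.2** (this file: a further model instance, on the block family of row B6.Main)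
and **B6.Main**; inputs BY NAME: the hypothesis-free first-order package (1.110)–(1.111) for `G′_K` on every torus
`B5DictTorusEta.firstOrderFam_top` (r02; [2]'s Theorem through `B4ThmZeroTorusEta`, residual entries `B5ResidualGpTorus`), r02's site bridge
and carrier maps `B5SiteBridgeP12` / `B5Carrier132Maps` (`pullV`, `σR`, `κR`, `dist_σR`, `supp_pullV`, `cutIn_κR`, `supNormV_pullV_le`,
`cutHV_κR_le`), and p01 g5's reading of (2.67) on the one-scale torus (`B6Prop22OneScaleTorus`: `G′ = Δ′_a⁻¹ = (tower P a m²).G K`,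
`gPrime_eq_deltaPrime_inv`)): T. Bałaban, *Propagators and renormalization transformations for lattice gauge theories. II*, Commun. Math.
Phys. **96** (1984) 223–250 [`Balaban1984PropagatorsII`, "B6"], Prop. 2.2 (2.67) p. 234, (2.13)–(2.14) p. 225; PDF held
`paper:balaban1984-cmp96-propagators-rt-ii` (journal page = PDF page + 222; pp. 225, 234 re-read on the text layer this session); T. Bałaban,
*… I*, Commun. Math. Phys. **95** (1984) 17–40 [`Balaban1984PropagatorsI`, "[4]"], Prop. 1.2 (1.110)–(1.111) p. 35, (1.135) p. 39.

## WHAT IS PRINTED (verbatim up to notation) AND HOW IT IS READ HERE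

Proposition 2.2 (p. 234): «If we have (2.1), (2.2) and M is sufficiently large, then the operator G′ = Δ′_a⁻¹ (a = 1) satisfies the
inequalities |(G′λ)(x)|, |(∇G′λ)(x)|, |(G′∇*λ)(x)|, ‖ζ∇G′λ‖_α, ‖ζG′∇*λ‖_α, |(ΔG′λ)(x)| ≤ O(1)[(L^jη)², L^jη, L^jη, (L^jη)^{1−α}(‖ζ‖_α + |ζ|),
(L^jη)^{1−α}(‖ζ‖_α + |ζ|), 1]·e^{−½δ₀d(y,y′)}|λ|, x ∈ B^j(y) or supp ζ ⊂ B^j(y), y ∈ Λ_j, supp λ ⊂ B^{j′}(y′), y′ ∈ Λ_{j′}. (2.67)»,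
with Δ′_a = Δ + Q′*aQ′, ⟨λ, Q′*aQ′λ⟩ = Σ_j Σ_{y∈Λ_j} a_j(L^jη)^{d−2}|(Q′_jλ)(y)|² (2.13)–(2.14).  ON ONE LEVEL (Ω₁ = … = Ω_K = T_η, all sites
at scale K, `L^jη = 1`, (2.1)–(2.2) void, `M = 1`) `Δ′_a` is the unit-lattice operator `−Δ^η + a_KQ′_K*Q′_K` and `G′ = G′_K` — [4]'s
(1.135) operator, the genuine `(B1RG242Torus.tower P a m²).G K = (−Δ^η + m² + a_KQ′_K*Q′_K)⁻¹` (p01's `gPrime_eq_deltaPrime_inv`; here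
`m² ≥ 0` is a parameter, the Proposition has m² = 0, and `a > 0`, the Proposition a = 1).  The six quantities are read through the
functionals OF RECORD of [4]'s Prop. 1.2 for G′ (`B5GpSettingTorus.gpSetting P a m² K`: `e n` = the sups over `x ∈ Δ̃(y)` of `|(G′_Kλ_μ)(x)|`,
`|(∂_μG′_Kλ_ν)(x)|`, `|(G′_K∇*λ)(x)|`, `|(ΔG′_Kλ_μ)(x)|` — `E0_top`, `ED_top`; `h1 = max(‖ζ∇G′λ‖_α, ‖ζG′∇*λ‖_α)` — `gpSetting_h1`), λ being a
MULTIPLET `Fin d → T_η → ℝ` ([3]'s f : Ω → R^N; G′ acts componentwise and `G′∇*λ` on its divergence), exactly as on p01's one-scale torus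
geometry.  The block geometry `B6MainResultsOneLevel.blockGeo` carries r02's LATTICE test functions `Loc = B5SettingP12Real.LocR` (the
sources of [4]'s Prop. 1.2 for the vector operator G: 1-forms `.vec`, and the 2-tensor sources `.ten`, `.ten2` of its ∇*-entries) and
lattice cut-offs; a 1-form `J = .vec F` IS a multiplet (`B5Carrier132Maps.pullV F μ x = F(eFine x, μ)`), unit sites correspond by `σR =
eUnit⁻¹`, cut-offs by `κR`, supports in `Δ̃` agree (`supp_pullV`, `cutIn_κR`), `|pullV F| ≤ |F|`, `‖κζ‖_α + |κζ| ≤ ‖ζ‖_α + |ζ|`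
(`supNormV_pullV_le`, `cutHV_κR_le`), `d(σy, σy′) = |y − y′|_∞` (`dist_σR`).  READING CHOICES (honest scope): supports `supp λ ⊂ B^{j′}(y′)`,
`supp ζ ⊂ B^j(y)` and `x ∈ B^j(y)` are read with [4]'s doubled cubes `Δ̃` (formally STRONGER, as in `B6Prop26OneScaleFromB5` and
`B6MainResultsOneLevel`); on the 2-tensor source kinds, which are not arguments of (2.67), the functionals are set to `0` (the only
reading available on a `Loc` shared with Prop. 2.6's sources; the bound there is the trivial `0 ≤ O(1)·e^{…}|λ|`).

## WHAT THIS FILE PROVES (kernel-checked; 0 sorry; no new `def … : Prop`; the inputs are USED BY NAME, not re-proved)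

* `blockGp d L a msq i` — the (2.67) functionals of the genuine `G′_K` on member `i` of the block family (`blockGp_e_vec`, `blockGp_h1_vec`:
  on 1-forms they ARE the `gpSetting` functionals of record at the pulled multiplet, `rfl`).
* **`prop22Printed_block (hd : 1 ≤ d) (hL : Odd L ∧ 1 < L) (ha : 0 < a) (hmsq : 0 ≤ msq) :
  B6.Prop22Printed (blockGeo d L a) (blockGp d L a msq)`** — witnesses `M₁ = 1`, `δ₀ := 2δ/d` (δ the [4] rate of `firstOrderFam_top`,
  `|·|₁ ≤ d|·|_∞`), `O(1) = C`, `O(1)(α) = max(C(α), 0)`; every prefactor `(L^jη)^{…} = 1` (`blockGeo_len`).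

## HONEST SCOPE ∕ NOT CLAIMED

ONE LEVEL ONLY, scalar model (U = 1), torus, constants those of the b05/r02 lineage (not the print's); the multi-level Proposition (the
random walk (2.50) over 𝔅, M large, (2.1)–(2.2)) remains the DAG hypothesis `B6.Prop22Printed` downstream and is the head instance of
row B6.Prop2.2 only through p01's one-scale torus family (p249487) — this file is a further member instance, on the geometry family of
row B6.Main, written so that the DAG leaf `b6` can be assembled on ONE `B6.BlockData` (`B6BlockParamOneLevel`, p314720).  NOT summit
progress.
-/

namespace Literature.MathematicalPhysics.QuantumFieldTheory.Balaban1983to89.B6Prop22BlockFamily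

open Literature.MathematicalPhysics.QuantumFieldTheory.Balaban1983to89.B6 (Geometry GpFamily Prop22Printed pref4)
open B6MainResultsOneLevel (blockGeo blockGeo_len)
open B6Prop26OneScaleFromB5 (dist1_le)
open B5ResidualGpTorusHolds (TopIdx)
open B5SiteBridgeP12 (nP MP)
open B5Prop11Plancherel (Tor fine)
open B5Prop12FieldsLattice (distSite supNormL cutHL supNormL_nonneg cutHL_nonneg)
open B5SettingP12Real (LocR)
open B5GpSettingTorus (gpSetting supNormV cutHV supNormV_nonneg cutHV_nonneg L2Half)
open B5Carrier132Maps (σR κR pullV dist_σR supp_pullV cutIn_κR supNormV_pullV_le cutHV_κR_le)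
open B5DictTorusEta (GpTopIdx firstOrderFam_top)

open scoped BigOperators
open Finset

noncomputable section

section Aux

variable {D : ℕ} (M : Fin D → ℕ) [hM : ∀ μ, NeZero (M μ)]

omit hM in
/-- the exponent conversion `e^{−κ|·|_∞} ≤ e^{−(κ/D)|·|₁}` (`|·|₁ ≤ D|·|_∞`, r03 g9's `dist1_le`). [folklore] -/
private theorem exp_rate_le_gen {κ : ℝ} (hκ : 0 ≤ κ) (hD : D ≠ 0) (y c : Tor M) :
    Real.exp (-(κ * distSite M y c)) ≤ Real.exp (-(κ / D * B6Prop26OneScaleFromB5.dist1 M y c)) := by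
  apply Real.exp_le_exp.mpr
  have hDpos : (0 : ℝ) < D := by exact_mod_cast Nat.pos_of_ne_zero hD
  have h := dist1_le M y c
  rw [neg_le_neg_iff, div_mul_eq_mul_div, div_le_iff₀ hDpos]
  calc κ * B6Prop26OneScaleFromB5.dist1 M y c ≤ κ * ((D : ℝ) * distSite M y c) := mul_le_mul_of_nonneg_left h hκ
    _ = κ * distSite M y c * D := by ring

/-- the prefactors `[(L^jη)², L^jη, L^jη, 1]` at `L^jη = 1`. [folklore] -/
private theorem pref4_one (n : Fin 4) : pref4 1 n = 1 := by
  fin_cases n <;> simp [pref4]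

end Aux

section Prop22

variable (d L : ℕ) (a : ℝ)

/-- **the (2.67) functionals of the genuine `G′ = G′_K = (−Δ^η + m² + a_KQ′_K*Q′_K)⁻¹` on member `i` of the block family**: on a 1-form
`J = .vec F` (a multiplet `pullV F`), `e n J y` = [4]'s (1.110) functional of record `(gpSetting P a m² K).e n` (sup over `x ∈ Δ̃(y₋)` of
`|(G′λ_μ)(x)|`, `|(∂_μG′λ_ν)(x)|`, `|(G′∇*λ)(x)|`, `|(ΔG′λ_μ)(x)|`) at the unit site `σR y₋`, and `h1 J α ζ` = `max(‖κζ·∇G′λ‖_α, ‖κζ·G′∇*λ‖_α)`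
(`gpSetting_h1`); on the 2-tensor source kinds (not arguments of (2.67)) the functionals are `0`.
[cite: Balaban1984PropagatorsII, Prop. 2.2 (2.67) p.234, (2.13)–(2.14) p.225; Balaban1984PropagatorsI, (1.110)–(1.111) p.35, (1.135) p.39] -/
def blockGp (msq : ℝ) (i : TopIdx d L) : GpFamily (blockGeo d L a i) where
  e := fun m J y => match (J : LocR (nP i.P) (MP i.P)) with
    | .vec F => (gpSetting i.P a msq i.P.K default).e m (pullV i.P F) (σR i.P y.1)
    | .ten _ => 0
    | .ten2 _ => 0
  h1 := fun J α ζ => match (J : LocR (nP i.P) (MP i.P)) with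
    | .vec F => (gpSetting i.P a msq i.P.K default).h1 (pullV i.P F) α (κR i.P ζ)
    | .ten _ => 0
    | .ten2 _ => 0

/-- certification: on 1-forms the sup functionals ARE [4]'s (1.110) functionals of record for `G′_K` at the pulled multiplet (definitional).
[cite: Balaban1984PropagatorsII, (2.67) p.234; Balaban1984PropagatorsI, (1.110) p.35] -/
theorem blockGp_e_vec (msq : ℝ) (i : TopIdx d L) (m : Fin 4) (F : Tor (fine (nP i.P) (MP i.P)) × Fin i.P.d → ℝ)
    (y : (blockGeo d L a i).Site) :
    (blockGp d L a msq i).e m (LocR.vec F) y = (gpSetting i.P a msq i.P.K default).e m (pullV i.P F) (σR i.P y.1) := rfl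

/-- certification: on 1-forms the Hölder functional IS `max(‖ζ∇G′λ‖_α, ‖ζG′∇*λ‖_α)` of record (`B5GpSettingTorus.gpSetting_h1`) at the pulled
multiplet and cut-off (definitional). [cite: Balaban1984PropagatorsII, (2.67) p.234; Balaban1984PropagatorsI, (1.111) p.35] -/
theorem blockGp_h1_vec (msq : ℝ) (i : TopIdx d L) (F : Tor (fine (nP i.P) (MP i.P)) × Fin i.P.d → ℝ) (α : ℝ)
    (ζ : (blockGeo d L a i).Cut) :
    (blockGp d L a msq i).h1 (LocR.vec F) α ζ = (gpSetting i.P a msq i.P.K default).h1 (pullV i.P F) α (κR i.P ζ) := rfl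

/-- **PROPOSITION 2.2 (2.67), VERBATIM (`B6.Prop22Printed`), ON THE ONE-LEVEL BLOCK FAMILY WITH NO HYPOTHESIS** (every `d ≥ 1`, odd
`L > 1`, `a > 0`, `m² ≥ 0`): witnesses `M₁ = 1`, `δ₀ = 2δ/d`, `O(1) = C`, `O(1)(α) = max(C(α), 0)` from r02's hypothesis-free first-order
package `B5DictTorusEta.firstOrderFam_top` for `G′_K` on every torus, transported along r02's carrier maps (`dist_σR`, `supp_pullV`,
`cutIn_κR`, `supNormV_pullV_le`, `cutHV_κR_le`) and `|·|₁ ≤ d|·|_∞`. [cite: Balaban1984PropagatorsII, Prop. 2.2 (2.67) p.234 (one level; constants ours)] -/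
theorem prop22Printed_block (hd : 1 ≤ d) (hL : Odd L ∧ 1 < L) (ha : 0 < a) {msq : ℝ} (hmsq : 0 ≤ msq) :
    Prop22Printed (blockGeo d L a) (blockGp d L a msq) := by
  obtain ⟨δ₀, C, Cα, hδ₀, hC, h⟩ := firstOrderFam_top d L hd hL ha hmsq (fun _ => default)
  have hdpos : (0 : ℝ) < d := by exact_mod_cast hd
  refine ⟨1, 2 * (δ₀ / d), C, fun α => max (Cα α) 0, one_pos, by positivity, hC, fun i _ _ => ?_⟩
  obtain ⟨hsup, hH1⟩ := h ⟨i.P, i.hPd, i.hPL, i.hK⟩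
  have hD : i.P.d ≠ 0 := by have := i.P.hd; omega
  have hrate : ∀ y c : Tor (MP i.P), Real.exp (-(δ₀ * distSite (MP i.P) y c)) ≤
      Real.exp (-(2 * (δ₀ / d) / 2 * B6Prop26OneScaleFromB5.dist1 (MP i.P) y c)) := by
    intro y c
    have h1 := exp_rate_le_gen (MP i.P) hδ₀.le hD y c
    have e : δ₀ / ((i.P.d : ℕ) : ℝ) = 2 * (δ₀ / d) / 2 := by rw [i.hPd]; ring
    rwa [e] at h1
  -- dictionary facts (r02's carrier maps `B5Carrier132Maps`)
  have hSnn : ∀ J : LocR (nP i.P) (MP i.P), 0 ≤ (blockGeo d L a i).supNorm J := fun J => by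
    show 0 ≤ supNormL (nP i.P) (MP i.P) (LocR.emb J); exact supNormL_nonneg _
  have hJle : ∀ F : Tor (fine (nP i.P) (MP i.P)) × Fin i.P.d → ℝ,
      supNormV i.P (pullV i.P F) ≤ (blockGeo d L a i).supNorm (LocR.vec F) := fun F => by
    show supNormV i.P (pullV i.P F) ≤ supNormL (nP i.P) (MP i.P) (LocR.emb (LocR.vec F)); exact supNormV_pullV_le i.P F
  have hcubeOf : ∀ (F : Tor (fine (nP i.P) (MP i.P)) × Fin i.P.d → ℝ) (c : (blockGeo d L a i).Site),
      (blockGeo d L a i).suppIn (LocR.vec F) c → (gpSetting i.P a msq i.P.K default).suppIn (pullV i.P F) (σR i.P c.1) :=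
    fun F c hsupp => supp_pullV i.P F c.1 (fun b hb => hsupp b (by show ((F b : ℝ) : ℂ) ≠ 0; exact_mod_cast hb))
  refine ⟨fun m J y c hsupp => ?_, fun α J ζ y c hα0 hα1 hζ hsupp => ?_⟩
  · rw [blockGeo_len, pref4_one, mul_one]
    rcases J with F | F | F
    · have key : (gpSetting i.P a msq i.P.K default).e m (pullV i.P F) (σR i.P y.1) ≤
          C * Real.exp (-(δ₀ * distSite (MP i.P) y.1 c.1)) * supNormV i.P (pullV i.P F) := by
        rw [← dist_σR i.P y.1 c.1]; exact hsup m (pullV i.P F) (σR i.P y.1) (σR i.P c.1) (hcubeOf F c hsupp)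
      have hJ0 : 0 ≤ supNormV i.P (pullV i.P F) := supNormV_nonneg (P := i.P) _
      calc (blockGp d L a msq i).e m (LocR.vec F) y
          = (gpSetting i.P a msq i.P.K default).e m (pullV i.P F) (σR i.P y.1) := rfl
        _ ≤ C * Real.exp (-(δ₀ * distSite (MP i.P) y.1 c.1)) * supNormV i.P (pullV i.P F) := key
        _ ≤ C * Real.exp (-(2 * (δ₀ / d) / 2 * B6Prop26OneScaleFromB5.dist1 (MP i.P) y.1 c.1)) *
              (blockGeo d L a i).supNorm (LocR.vec F) :=
            mul_le_mul (mul_le_mul_of_nonneg_left (hrate y.1 c.1) hC.le) (hJle F) hJ0 (by positivity)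
    · have h0 : (blockGp d L a msq i).e m (LocR.ten F) y = 0 := rfl
      rw [h0]; exact mul_nonneg (by positivity) (hSnn _)
    · have h0 : (blockGp d L a msq i).e m (LocR.ten2 F) y = 0 := rfl
      rw [h0]; exact mul_nonneg (by positivity) (hSnn _)
  · rw [blockGeo_len, Real.one_rpow, mul_one]
    beta_reduce
    have hCα : 0 ≤ max (Cα α) 0 := le_max_right _ _
    have hZ0 : 0 ≤ (blockGeo d L a i).cutH α ζ := cutHL_nonneg α ζ
    rcases J with F | F | F
    · have hcubeζ : (gpSetting i.P a msq i.P.K default).cutIn (κR i.P ζ) (σR i.P y.1) := cutIn_κR i.P ζ y.1 hζ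
      have key : (gpSetting i.P a msq i.P.K default).h1 (pullV i.P F) α (κR i.P ζ) ≤
          Cα α * Real.exp (-(δ₀ * distSite (MP i.P) y.1 c.1)) * cutHV i.P i.P.K α (κR i.P ζ) * supNormV i.P (pullV i.P F) := by
        rw [← dist_σR i.P y.1 c.1]
        exact hH1 α (pullV i.P F) (κR i.P ζ) (σR i.P y.1) (σR i.P c.1) hα0 hα1 hcubeζ (hcubeOf F c hsupp)
      have hJ0 : 0 ≤ supNormV i.P (pullV i.P F) := supNormV_nonneg (P := i.P) _
      have hZ : cutHV i.P i.P.K α (κR i.P ζ) ≤ (blockGeo d L a i).cutH α ζ := by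
        show cutHV i.P i.P.K α (κR i.P ζ) ≤ cutHL (nP i.P) (MP i.P) α ζ; exact cutHV_κR_le i.P α ζ
      have hZ0' : 0 ≤ cutHV i.P i.P.K α (κR i.P ζ) := cutHV_nonneg (P := i.P) i.P.K α (κR i.P ζ)
      have hE := hrate y.1 c.1
      have hE0 : 0 ≤ Real.exp (-(δ₀ * distSite (MP i.P) y.1 c.1)) := (Real.exp_pos _).le
      calc (blockGp d L a msq i).h1 (LocR.vec F) α ζ
          = (gpSetting i.P a msq i.P.K default).h1 (pullV i.P F) α (κR i.P ζ) := rfl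
        _ ≤ Cα α * Real.exp (-(δ₀ * distSite (MP i.P) y.1 c.1)) * cutHV i.P i.P.K α (κR i.P ζ) * supNormV i.P (pullV i.P F) := key
        _ = Cα α * (Real.exp (-(δ₀ * distSite (MP i.P) y.1 c.1)) * cutHV i.P i.P.K α (κR i.P ζ) * supNormV i.P (pullV i.P F)) := by
            ring
        _ ≤ max (Cα α) 0 * (Real.exp (-(δ₀ * distSite (MP i.P) y.1 c.1)) * cutHV i.P i.P.K α (κR i.P ζ) *
              supNormV i.P (pullV i.P F)) :=
            mul_le_mul_of_nonneg_right (le_max_left _ _) (mul_nonneg (mul_nonneg hE0 hZ0') hJ0)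
        _ ≤ max (Cα α) 0 * (Real.exp (-(2 * (δ₀ / d) / 2 * B6Prop26OneScaleFromB5.dist1 (MP i.P) y.1 c.1)) *
              (blockGeo d L a i).cutH α ζ * (blockGeo d L a i).supNorm (LocR.vec F)) :=
            mul_le_mul_of_nonneg_left (mul_le_mul (mul_le_mul hE hZ hZ0' (by positivity)) (hJle F) hJ0
              (mul_nonneg (by positivity) hZ0)) hCα
        _ = max (Cα α) 0 * (blockGeo d L a i).cutH α ζ *
              Real.exp (-(2 * (δ₀ / d) / 2 * B6Prop26OneScaleFromB5.dist1 (MP i.P) y.1 c.1)) *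
              (blockGeo d L a i).supNorm (LocR.vec F) := by ring
    · have h0 : (blockGp d L a msq i).h1 (LocR.ten F) α ζ = 0 := rfl
      rw [h0]; exact mul_nonneg (mul_nonneg (mul_nonneg hCα hZ0) (Real.exp_pos _).le) (hSnn _)
    · have h0 : (blockGp d L a msq i).h1 (LocR.ten2 F) α ζ = 0 := rfl
      rw [h0]; exact mul_nonneg (mul_nonneg (mul_nonneg hCα hZ0) (Real.exp_pos _).le) (hSnn _)

/-- **non-vacuity**: every member meets the hypotheses with the witness `M₁ = 1` ((2.1)–(2.2) void, `M = 1`), and the family has a member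
for every volume and every scale `K ≥ 1` (`B6Prop26OneScaleFromB5.topIdx_nonempty`). [cite: Balaban1984PropagatorsII, Prop. 2.2 p.234] -/
theorem blockGp_meets_hypotheses (i : TopIdx d L) : (blockGeo d L a i).Hyp21_22 ∧ (1 : ℝ) ≤ (blockGeo d L a i).M :=
  ⟨trivial, le_rfl⟩

end Prop22

end

end Literature.MathematicalPhysics.QuantumFieldTheory.Balaban1983to89.B6Prop22BlockFamily
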